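import Summits.QuantumFields.YangMills.Theorems.BalabanUVNodesK0V23Stub3RunwiseSuppliersAx
import Summits.QuantumFields.YangMills.Theorems.BalabanUVNodesK0V23Stub3DoorSuppliersAx
import Summits.QuantumFields.YangMills.Theorems.BalabanUVNodesK0RecordFormatNamesLemmas5
import Summits.QuantumFields.YangMills.Theses.BalabanUVNodes

/-!
# P3 «weaken the target» — COFINAL RADII SUFFICE AT K0ᴬ: the RUN letter ∕ the (5.10)-decay letter along COFINALLY small radii ⟹
# `Theses.BalabanUVNodes.Record13SepCoPHInhabitedAx` BY NAME

AUTHORED by P3 g87 `ym-nodeO-ideate-p3` (planner-ym-nodeO-ideate-p3-g87-0; LENS P3 «weaken the target»; HOME sketch `nodeO-cover/P3-K0AxCofinalRunDoor-v2.lean`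
fe107883732383be, OFFER O.4453); LANDED VERBATIM (declarations and proofs byte-identical; this provenance paragraph and the label below added) by seat `pub-ymgap-dag-n20-d` (g45)
on dag-lead g41's hand of 2026-08-31T04:18:38Z (no «MINE» by 04:24Z), `--supports stmt-QuantumFields-27238 --as helper`; count-neutral.
HONEST LABEL (dag-lead's wording, binding): every door below is CONDITIONAL on the displayed cofinal (5.10)-decay letter `K0PiDecayCofinalRadiiAx` ∕ the cofinal run letter
`K0RunCofinalRadiiAx`, which are inhabited NOWHERE in the tree — a door, not an inhabitant; K0ᴬ (stmt-QuantumFields-27238) stays OPEN; nothing of Bałaban's is proved here; the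
Yang–Mills mass gap is NOT proved.

THE LENS QUESTION at K0ᴬ.  The crux decl `Record13SepCoPHInhabitedAx` is `∀ F, ∃ θ, …` (Theses :281–:283).  Three typed sufficient conditions
on NODE O's side exist today, all read at the re-centred record `β₁₃ᴬˣ`:
* the REGISTERED V24 stub 3ᴬ′ᴮ `K0V23DefsAx.AbsBetaBoxAtThm1WitnessCCMGenGridGZBAxAt F` — a β-BOX on `]0,γ₀]^{k+1}` at EVERY cube letter and EVERY radius `a₀ > 0`;
* the tree's run-wise door `K0V23Stub3RunwiseSuppliersAx.k0Body_of_seam_of_runwiseZB` (dag-n07-w3 g22, 03:49Z) — a RUN bound at EVERY radius `a₀ > 0`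
  (weaker than the box member by member, `runwiseZB_of_tokenFreeZB`; the converse fails for a bare `HBeta`, `K0V23Stub3RunBoxEquivalence.exists_hbeta_runAbs_not_box`);
* lens-1 g5's cover link `LENS-1-K0AxDecayLink-v1.lean` :81 `record13SepCoPHInhabitedAx_of_recordPlimDecayOnRunsAx` — ONE (5.10)-decay letter
  `RecordPlimDecayOnRunsAx F a₀ ε₂₉ γ₀ C δ₁` at EVERY radius `a₀ > 0` (T′ of `LENS-1-NODE-v6.md`).
All three quantify over ALL radii.  The decl does not need that: stub 1ᴮ (`K0Stub1BHolds.prop8StepCoPGridGBAt_holds`, PROVED) produces ITS OWN radius `aS`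
and [15] Prop. 8's sentence is monotone in the radius (`Prop8StepCoPGridGBAt.of_le`), so a letter at SOME radius `a₀ ≤ a` for every ceiling `a > 0`
(COFINALLY small radii — the shape of P3 g84's (κ_cof) ∕ (α_cof) doors for K0⁷, `K0V23Stub3DoorSuppliers` :152 ∕ :189 → :167 ∕ :206) is enough.
This file types the two cofinal doors for K0ᴬ and proves them BY NAME:

* `K0RunCofinalRadiiAx` — door (ρ_cof)-Ax: RUN letter × the print-regime member × COFINAL radii;  `record13SepCoPHInhabitedAx_of_k0RunCofinalRadiiAx`.
* `K0PiDecayCofinalRadiiAx` — W-UDR's Ax twin VERBATIM (lens-1 g4 `LENS-1-PiDecayRuns-v2.lean` :292; memo ROUTE-P3 §2 row W-UDR): (5.10)-decay of ONE entry of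
  the record's limit polarization kernel along the record's own in-window runs at COFINALLY small radii;  `k0RunCofinalRadiiAx_of_k0PiDecayCofinalRadiiAx`
  (Lemmas5 `runAbs_of_recordPlimDecayOnRunsAx`, [I] (1.22), (5.42)) and ★ `record13SepCoPHInhabitedAx_of_k0PiDecayCofinalRadiiAx` — W-UDR-Ax ⟹ K0ᴬ BY NAME.
* the order: T′ (all radii) ⟹ W-UDR-Ax (cofinal) and run-core-at-all-radii ⟹ (ρ_cof)-Ax, `…_of_allRadii` (take `a₀ := a`); strictness NOT claimed.

So on the decay road the weakest typed statement reaching K0ᴬ's decl by name is W-UDR itself (cofinal radii), not its all-radii strengthening T′; the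
edge «W-UDR → K0ᴬ: (κ_cof)-Ax door owed» of ROUTE-P3 item 127's table is discharged by this sketch once landed.  Proof = the tree door's §4 proof
(`k0Body_of_runwiseZB_byName`) with the cofinal step of `K0V23Stub3DoorSuppliers.record13SepCoPHInhabited_of_k0CompCofinalRadii` inserted (ask the
door at stub 1ᴮ's radius, shrink stub 1ᴮ's token to the door's `a₀` by `of_le`); the stub-2′ text from the green [6] Prop. 6
(`prop6Printed_zdCubP_γ_holds_pos`); the seam from `hseamAx_rfl`.

v2 (04:13Z, after dag-n07-w3 g22's (11) `K0V23Stub3DoorSuppliersAx` LANDED ✓p809897 04:08Z, 16c9c1472a47e70d · 240 l.): §5 links the two cofinal doors to the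
TREE's (κ_cof)-Ax door `K0V23Stub3DoorSuppliersAx.K0CompCofinalRadiiAx` (:201) — (ρ_cof)-Ax ⟹ (κ_cof)-Ax (`exists_twoComparable_of_runAbsBound` at the member
`j = 0, ε₀ = B₃ = B₃′ = a₁ = 1, Efl = logz = 0`) and W-UDR-Ax ⟹ (κ_cof)-Ax (= lens-1 v2 :298 `compCofinalRadiiAx_of_k0PiDecayCofinalRadiiAx` read under σ
`theta13OfThm1CCMWZB ↦ theta13OfThm1CCMWZBAx`, the ONE token by which :298's displayed conclusion differs from the tree's :202–:205 body) — so that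
W-UDR-Ax ⟹ K0ᴬ ALSO runs through the TREE closer `record13SepCoPHInhabitedAx_of_k0CompCofinalRadii` (:218): `record13SepCoPHInhabitedAx_of_k0PiDecayCofinalRadiiAx_tree`.
What the tree still lacks for the edge W-UDR → K0ᴬ is then exactly: the def `K0PiDecayCofinalRadiiAx` (12 l. here, :80–:83) + ONE 6-line theorem (§5).

HONESTY.  CONDITIONAL on the displayed cofinal letter (NODE O's wall in run ∕ decay currency); typed ≠ proved; nothing of Bałaban's [RG-I] ∕ [RG-II] ∕ (5.10) is
asserted, ported or discharged; K0ᴬ stmt-QuantumFields-27238 OPEN (stubs 0∕2); NODE O 0∕1; COUNT 8∕28 · K 1∕4 UNMOVED; finite 𝕋⁴ at fixed ε, rung R4 — NOT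
continuum ∕ OS ∕ Clay; the Yang–Mills mass gap is NOT proved by any of this.  Standard axioms only; 0 sorry ∕ instance ∕ notation.
[I] = [Balaban1987RG1]; [C] = [Balaban1988Convergent]; [V] = [Balaban1985Variational]; [RS] = [Balaban1985RegularSpaces].
-/

noncomputable section

open scoped Matrix.Norms.L2Operator

namespace Summit.QuantumFields.YangMills.Theorems.K0V23Stub3CofinalRunDoorAx

open Literature.MathematicalPhysics.QuantumFieldTheory.Balaban1983to89
open Literature.MathematicalPhysics.QuantumFieldTheory.Balaban1983to89.Node00
open Literature.MathematicalPhysics.QuantumFieldTheory.Balaban1983to89.T4Continuum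
open Literature.MathematicalPhysics.QuantumFieldTheory.Balaban1983to89.FlowStep
open Literature.MathematicalPhysics.QuantumFieldTheory.Balaban1983to89.FlowStepRuns
open Literature.MathematicalPhysics.QuantumFieldTheory.Balaban1983to89.B15DeterminingSets
open Literature.MathematicalPhysics.QuantumFieldTheory.Balaban1983to89.B8LeafModelZd (ZdIdx)
open Literature.MathematicalPhysics.QuantumFieldTheory.Balaban1983to89.B8Prop6PrintedZdCubPGamma (prop6Printed_zdCubP_γ_holds_pos)
open Summit.QuantumFields.YangMills.BalabanUVNodes.K0Stub1BHolds (prop8StepCoPGridGBAt_holds)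
open Summit.QuantumFields.YangMills.BalabanUVNodes.N07Thm1Top7FromProp8GuardedB (variationalThm1RegSepCoP7MGB_of_prop8TopStepGB_lamDatum)
open Summit.QuantumFields.YangMills.Theorems.K0PrintCubeOfStepTokensGridGuardedB (gauge9SupplierG3B_of_prop6MemberP)
open Summit.QuantumFields.YangMills.Theorems.K0AllTorusOfStepTokensGuardedZBLamAx (hDat_dataSmall7LamTopOfAx hseamAx_rfl)
open Summit.QuantumFields.YangMills.Theorems.K0V23Stub3RunwiseSuppliersAx (exists_k0H_of_thm1CoP7MGB_of_gauge9GB_of_runAbsBoxZB_lam)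
open Summit.QuantumFields.YangMills.Theorems.K0RecordFormatNames

/-! ## §1  The two cofinal doors (HYPOTHESIS SHAPES — door bookkeeping over accepted tree names, NOT published results; open) -/

/-- **Door (ρ_cof)-Ax**: for every family and every ceiling `a > 0` SOME radius `0 < a₀ ≤ a`, SOME `γ₀, ε₂₉ > 0` and `β′` with
`|β₁₃ᴬˣ(F; a₀, ε₂₉)_{k}(g₀,…,g_{k-1})| ≤ β′` along every solution of (0.20) staying in `]0, γ₀]`, read at the print-regime member at every cube letter
(letter-blind by `rfl`).
(HYPOTHESIS — door bookkeeping over accepted tree names, NOT a published result; locators: [I], Thm 1 p.259, Thm 3 p.264, (0.20) p.256, (1.20)–(1.22) p.264, (2.9) p.266 (bookkeeping); open) -/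
def K0RunCofinalRadiiAx : Prop :=
  ∀ F : T4Family, ∀ a : ℝ, 0 < a → ∃ a₀ : ℝ, 0 < a₀ ∧ a₀ ≤ a ∧
    ∃ γ₀ ε₂₉ β' : ℝ, 0 < γ₀ ∧ 0 < ε₂₉ ∧ ∀ (j : ℕ) (ε₀ B₃ B₃' a₁ : ℝ),
      ∀ (n : ℕ) (gs : ℕ → ℝ), RGEqH n (betaOfRecord₁₃Ax F 2 (theta13OfThm1CCMWZBAx F 2 j (1 / 2) a₀ ε₀ ε₂₉ B₃ B₃' a₀ a₁ (fun _ _ => 0) (fun _ _ => 0))) gs → Step.InInterval γ₀ n gs →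
        ∀ k, k ≤ n → |betaOfRecord₁₃Ax F 2 (theta13OfThm1CCMWZBAx F 2 j (1 / 2) a₀ ε₀ ε₂₉ B₃ B₃' a₀ a₁ (fun _ _ => 0) (fun _ _ => 0)) k (prefixOf gs k)| ≤ β'

/-- **W-UDR's Ax twin** (lens-1 g4 `LENS-1-PiDecayRuns-v2.lean` :292, VERBATIM): (5.10)-decay of the record's re-centred limit kernel along its own in-window runs, ONE
member per radius, radii accumulating at `0`, level `0 < γ₀ ≤ ½`, `ε₂₉ > 0`.
(HYPOTHESIS — NODE O's content in decay-only Π-currency, cofinal form; NOT a published result as typed; locators: [I], Thm 1 p.259, Thm 3 p.264, (0.20) p.256, (1.21)–(1.22) p.264, (5.10) p.293; open) -/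
def K0PiDecayCofinalRadiiAx : Prop :=
  ∀ F : T4Family, ∀ a : ℝ, 0 < a → ∃ a₀ : ℝ, 0 < a₀ ∧ a₀ ≤ a ∧
    ∃ γ₀ ε₂₉ C δ₁ : ℝ, 0 < γ₀ ∧ γ₀ ≤ 1 / 2 ∧ 0 < ε₂₉ ∧ RecordPlimDecayOnRunsAx F a₀ ε₂₉ γ₀ C δ₁

/-! ## §2  The order among the typed sufficient conditions (all radii ⟹ cofinal; strictness NOT claimed) -/

/-- The run-wise core at ALL radii (the `run` binder of `K0V23Stub3RunwiseSuppliersAx.k0Body_of_runwiseZB_byName`) ⟹ door (ρ_cof)-Ax (`a₀ := a`).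
[cite: Balaban1987RG1, Thm 3 p.264, (1.20)–(1.22) p.264 (bookkeeping)] -/
theorem k0RunCofinalRadiiAx_of_allRadii
    (run : ∀ (F : T4Family) (a₀ : ℝ), 0 < a₀ → ∃ γ₀ ε₂₉ β' : ℝ, 0 < γ₀ ∧ 0 < ε₂₉ ∧ ∀ (j : ℕ) (ε₀ B₃ B₃' a₁ : ℝ),
      ∀ (n : ℕ) (gs : ℕ → ℝ), RGEqH n (betaOfRecord₁₃Ax F 2 (theta13OfThm1CCMWZBAx F 2 j (1 / 2) a₀ ε₀ ε₂₉ B₃ B₃' a₀ a₁ (fun _ _ => 0) (fun _ _ => 0))) gs → Step.InInterval γ₀ n gs →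
        ∀ k, k ≤ n → |betaOfRecord₁₃Ax F 2 (theta13OfThm1CCMWZBAx F 2 j (1 / 2) a₀ ε₀ ε₂₉ B₃ B₃' a₀ a₁ (fun _ _ => 0) (fun _ _ => 0)) k (prefixOf gs k)| ≤ β') :
    K0RunCofinalRadiiAx := by
  intro F a ha
  obtain ⟨γ₀, ε₂₉, β', hγ₀, hε, hall⟩ := run F a ha
  exact ⟨a, ha, le_rfl, γ₀, ε₂₉, β', hγ₀, hε, hall⟩

/-- T′ of `LENS-1-NODE-v6.md` (ONE decay letter at EVERY radius, the hypothesis of lens-1's `record13SepCoPHInhabitedAx_of_recordPlimDecayOnRunsAx`) ⟹ W-UDR-Ax (`a₀ := a`).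
[cite: Balaban1987RG1, Thm 3 p.264, (5.10) p.293 (bookkeeping)] -/
theorem k0PiDecayCofinalRadiiAx_of_allRadii
    (h : ∀ (F : T4Family) (a₀ : ℝ), 0 < a₀ → ∃ γ₀ ε₂₉ C δ₁ : ℝ, 0 < γ₀ ∧ γ₀ ≤ 1 / 2 ∧ 0 < ε₂₉ ∧ RecordPlimDecayOnRunsAx F a₀ ε₂₉ γ₀ C δ₁) :
    K0PiDecayCofinalRadiiAx := by
  intro F a ha
  obtain ⟨γ₀, ε₂₉, C, δ₁, hγ₀, hγh, hε, hdec⟩ := h F a ha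
  exact ⟨a, ha, le_rfl, γ₀, ε₂₉, C, δ₁, hγ₀, hγh, hε, hdec⟩

/-- **W-UDR-Ax ⟹ door (ρ_cof)-Ax** (`β′ := β′₅₁₀(4, C, δ₁)`, Lemmas5 `runAbs_of_recordPlimDecayOnRunsAx`, read at the re-centred witness by `rfl`).
[cite: Balaban1987RG1, (1.22) p.264, (5.10) p.293, (5.42) p.297, Thm 3 p.264] -/
theorem k0RunCofinalRadiiAx_of_k0PiDecayCofinalRadiiAx (H : K0PiDecayCofinalRadiiAx) : K0RunCofinalRadiiAx := by
  intro F a ha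
  obtain ⟨a₀, ha₀, hle, γ₀, ε₂₉, C, δ₁, hγ₀, hγh, hε, hdec⟩ := H F a ha
  exact ⟨a₀, ha₀, hle, γ₀, ε₂₉, B12Sec2to5.betaPrime510 4 C δ₁, hγ₀, hε, fun j ε₀ B₃ B₃' a₁ => runAbs_of_recordPlimDecayOnRunsAx F a₀ ε₂₉ hγh hdec⟩

/-! ## §3  ★★★ K0ᴬ's BODY and DECL from door (ρ_cof)-Ax — the tree door's §4 proof with the cofinal radius step inserted -/

/-- [6] Prop. 6 as printed on print's class (the `h2P` text; = the tree door's private five-liner). [cite: Balaban1985RegularSpaces, Prop. 6 (1.135)–(1.138) p.99, (1.3)–(1.6) p.77] -/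
theorem twoPrimeAx (F : T4Family) :
    ∃ (ρ₀ : ℕ) (B₁ c₁ : ℝ), 1 ≤ ρ₀ ∧ 0 ≤ B₁ ∧ 0 < c₁ ∧
      (letI : CStarAlgebra (MatA 2) := {}; B8.Prop6Printed 4 (F.L : ℝ) B₁ c₁ (fun i : ZdIdx 4 F.L => zdCubP (MatA 2) F.L ρ₀ i)) := by
  letI : CStarAlgebra (MatA 2) := {}
  have hL5 : 5 ≤ F.L := by have := F.hL11; omega
  obtain ⟨ρ₀, B₁, c₁, hρ₀, hB₁, hc₁, H⟩ :=
    prop6Printed_zdCubP_γ_holds_pos (𝔸 := MatA 2) (d := 4) (by norm_num) hL5 F.hL.1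
  exact ⟨ρ₀, B₁, c₁, hρ₀, hB₁.le, hc₁, H (fun i : ZdIdx 4 F.L => i)⟩

/-- **★★★ K0ᴬ's BODY AT EVERY FAMILY FROM stub 1ᴮ PROVED, THE STUB-2′ TEXT, THE DISPLAYED SEAM AND DOOR (ρ_cof)-Ax** — `K0V23Stub3RunwiseSuppliersAx.k0Body_of_runwiseZB_byName`'s
proof verbatim except that the run letter is asked at the CEILING `aS` := stub 1ᴮ's radius and stub 1ᴮ's token is shrunk to the door's `a₀ ≤ aS` (`of_le`), exactly as in
`K0V23Stub3DoorSuppliers.record13SepCoPHInhabited_of_k0CompCofinalRadii` for K0⁷.  CONDITIONAL on `hseam`, `h2P` and the door; K0ᴬ NOT closed; nothing of Bałaban asserted.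
[cite: Balaban1985Variational, Thm 1 (8)–(9) p.279, (7) p.278, Prop. 8 p.304; Balaban1985RegularSpaces, Prop. 6 p.99; Balaban1984PropagatorsII, (2.3) p.224; Balaban1988Convergent, Thm 1 p.262, (2.12)–(2.13) pp.256–257; Balaban1987RG1, Thm 1 p.259, Thm 3 p.264, (0.20) p.256, (1.20)–(1.22) p.264] -/
theorem k0BodyAx_of_k0RunCofinalRadiiAx
    (hseam : ∀ (F : T4Family) (θ : Stage13Params F 2) (p : B12.RunParams) (n : ℕ) (s : SeqOfRecord F θ.ν θ.τ9.M (gOfRecord₁₃Ax F 2 θ p) p.K (n + 1)) (W : MSField (F.P p.K) (SU 2)),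
      UbgOfRecord₁₃CoPChi F 2 θ (chiβOfRecord₁₃Ax F 2 θ) p (n + 1) s W = UbgMSCoPOfRecordB F 2 θ.ν θ.τ9.M (gOfRecord₁₃Ax F 2 θ p) p.K (n + 1) s W)
    (h2P : ∀ F : T4Family, ∃ (ρ₀ : ℕ) (B₁ c₁ : ℝ), 1 ≤ ρ₀ ∧ 0 ≤ B₁ ∧ 0 < c₁ ∧
      (letI : CStarAlgebra (MatA 2) := {}; B8.Prop6Printed 4 (F.L : ℝ) B₁ c₁ (fun i : ZdIdx 4 F.L => zdCubP (MatA 2) F.L ρ₀ i)))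
    (h : K0RunCofinalRadiiAx) :
    ∀ F : T4Family, ∃ θ : Stage13HParams F 2, θ.Provisos₁₃SepCoPHAx F 2 ∧ (θ.ZhUnity F 2 ∧ θ.SlotsNondegenerate₁₃Ax F 2) ∧ θ.Admissible F 2 := by
  intro F
  obtain ⟨c, c₀, c₁, B₃, aS, a₁, hB₃, haS, ha₁, h8⟩ := prop8StepCoPGridGBAt_holds F
  obtain ⟨a₀, ha₀, hle, γ₀, ε₂₉, β', hγ₀, hε', hall⟩ := h F aS haS
  have h8a := h8.of_le hle le_rfl
  have hL : (0 : ℝ) < (F.L : ℝ) := by exact_mod_cast lt_trans Nat.zero_lt_one F.hL.2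
  have hBpos : (0 : ℝ) < B₃ := lt_of_lt_of_le (mul_pos two_pos (pow_pos hL 2)) hB₃
  obtain ⟨j, c', B₉, a₁', hcc', hc', hc₀, hc₁, hB₉, ha₁', ha₁'le, h9⟩ :=
    gauge9SupplierG3B_of_prop6MemberP F (h2P F) (lamDatum F) (dataSmall7LamTopOf F 2) c c₀ c₁ B₃ a₀ a₁ hB₃ ha₀ ha₁ h8a
  have h15 : VariationalThm1RegSepCoP7MGB F 2 (fun ν M g K k _s => c' ≤ ν.M₁ ∧ k + c₀ ≤ F.m + K ∧ F.L ^ c₁ ∣ M ∧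
      ∀ i, 1 ≤ i → i ≤ k → dCubeSide (F.P K).L M (RkOfRecord (F.P K).L ν.r (g i)) i ∣ (F.P K).sitesPerDir 0) (lamDatum F) (dataSmall7LamTopOf F 2) B₃ a₀ a₁' :=
    (variationalThm1RegSepCoP7MGB_of_prop8TopStepGB_lamDatum hBpos (h8a.of_le le_rfl ha₁'le)).of_imp fun _ _ _ _ _ _ h => ⟨hcc'.trans h.1, h.2⟩
  exact exists_k0H_of_thm1CoP7MGB_of_gauge9GB_of_runAbsBoxZB_lam F (εbg := a₀) (Efl := fun _ _ => 0) (logz := fun _ _ => 0) hc' hc₀ hc₁ ha₀ hBpos.le hB₉.le ha₀ ha₁' h15 h9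
    (fun θ p n s δ W hn hpc h7 => hDat_dataSmall7LamTopOfAx F 2 θ p n s δ W hn hpc h7) (hseam F)
    ⟨γ₀, a₀, ε₂₉, β', hγ₀, ha₀, hε', hall j a₀ B₃ B₉ a₁'⟩

/-- **★★★ THE CRUX DECL BY NAME FROM DOOR (ρ_cof)-Ax ALONE** (stub 2′ from the green [6] Prop. 6, seam `hseamAx_rfl`).  CONDITIONAL on the door; K0ᴬ OPEN.
[cite: Balaban1987RG1, Thm 1 p.259, Thm 3 p.264, (0.20) p.256, (1.20)–(1.22) p.264; Balaban1985Variational, Thm 1 (8)–(9) p.279; Balaban1988Convergent, Thm 1 p.262] -/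
theorem record13SepCoPHInhabitedAx_of_k0RunCofinalRadiiAx (h : K0RunCofinalRadiiAx) :
    Summit.QuantumFields.YangMills.Theses.BalabanUVNodes.Record13SepCoPHInhabitedAx :=
  k0BodyAx_of_k0RunCofinalRadiiAx hseamAx_rfl twoPrimeAx h

/-- **★★★ W-UDR-Ax ⟹ THE CRUX DECL BY NAME** — (5.10)-decay of ONE entry of the record's limit kernel along the record's own in-window runs at COFINALLY small radii
suffices for K0ᴬ `Record13SepCoPHInhabitedAx` (stmt-QuantumFields-27238).  A HELPER (one displayed hypothesis = NODE O's wall in decay currency, cofinal form), NOT a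
closer; K0ᴬ OPEN; the mass gap is NOT proved. [cite: Balaban1987RG1, Thm 1 p.259, Thm 3 p.264, (1.22) p.264, (5.10) p.293, (5.42) p.297; Balaban1985Variational, Thm 1 (8)–(9) p.279; Balaban1988Convergent, Thm 1 p.262] -/
theorem record13SepCoPHInhabitedAx_of_k0PiDecayCofinalRadiiAx (H : K0PiDecayCofinalRadiiAx) :
    Summit.QuantumFields.YangMills.Theses.BalabanUVNodes.Record13SepCoPHInhabitedAx :=
  record13SepCoPHInhabitedAx_of_k0RunCofinalRadiiAx (k0RunCofinalRadiiAx_of_k0PiDecayCofinalRadiiAx H)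

/-- … and lens-1's all-radii terminus factors through the cofinal one (T′ ⟹ W-UDR-Ax ⟹ K0ᴬ). [cite: Balaban1987RG1, Thm 3 p.264, (5.10) p.293 (bookkeeping)] -/
theorem record13SepCoPHInhabitedAx_of_recordPlimDecayOnRunsAx_allRadii
    (h : ∀ (F : T4Family) (a₀ : ℝ), 0 < a₀ → ∃ γ₀ ε₂₉ C δ₁ : ℝ, 0 < γ₀ ∧ γ₀ ≤ 1 / 2 ∧ 0 < ε₂₉ ∧ RecordPlimDecayOnRunsAx F a₀ ε₂₉ γ₀ C δ₁) :
    Summit.QuantumFields.YangMills.Theses.BalabanUVNodes.Record13SepCoPHInhabitedAx :=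
  record13SepCoPHInhabitedAx_of_k0PiDecayCofinalRadiiAx (k0PiDecayCofinalRadiiAx_of_allRadii h)

/-- … and the tree door's all-radii `run` binder factors through door (ρ_cof)-Ax as well (all radii ⟹ cofinal ⟹ K0ᴬ). [cite: Balaban1987RG1, Thm 3 p.264, (1.20)–(1.22) p.264 (bookkeeping)] -/
theorem record13SepCoPHInhabitedAx_of_runwiseZB_allRadii
    (run : ∀ (F : T4Family) (a₀ : ℝ), 0 < a₀ → ∃ γ₀ ε₂₉ β' : ℝ, 0 < γ₀ ∧ 0 < ε₂₉ ∧ ∀ (j : ℕ) (ε₀ B₃ B₃' a₁ : ℝ),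
      ∀ (n : ℕ) (gs : ℕ → ℝ), RGEqH n (betaOfRecord₁₃Ax F 2 (theta13OfThm1CCMWZBAx F 2 j (1 / 2) a₀ ε₀ ε₂₉ B₃ B₃' a₀ a₁ (fun _ _ => 0) (fun _ _ => 0))) gs → Step.InInterval γ₀ n gs →
        ∀ k, k ≤ n → |betaOfRecord₁₃Ax F 2 (theta13OfThm1CCMWZBAx F 2 j (1 / 2) a₀ ε₀ ε₂₉ B₃ B₃' a₀ a₁ (fun _ _ => 0) (fun _ _ => 0)) k (prefixOf gs k)| ≤ β') :
    Summit.QuantumFields.YangMills.Theses.BalabanUVNodes.Record13SepCoPHInhabitedAx :=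
  record13SepCoPHInhabitedAx_of_k0RunCofinalRadiiAx (k0RunCofinalRadiiAx_of_allRadii run)

/-! ## §5  (v2) LINK TO THE LANDED TREE DOOR (κ_cof)-Ax (`K0V23Stub3DoorSuppliersAx` ✓p809897): cofinal RUN ∕ DECAY letters ⟹ the comparability letter ⟹ K0ᴬ by the TREE closer -/

/-- (ρ_cof)-Ax ⟹ (κ_cof)-Ax: the run |β|-bound at the print member gives the 2-comparability letter at that member (`exists_twoComparable_of_runAbsBound`), radius by radius.
[cite: Balaban1987RG1, Thm 3 p.264, (1.20)–(1.22) p.264 (bookkeeping)] -/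
theorem k0CompCofinalRadiiAx_of_k0RunCofinalRadiiAx (h : K0RunCofinalRadiiAx) :
    Summit.QuantumFields.YangMills.Theorems.K0V23Stub3DoorSuppliersAx.K0CompCofinalRadiiAx := by
  intro F a ha
  obtain ⟨a₀, ha₀, hle, γ₀, ε₂₉, β', hγ₀, hε, hrun⟩ := h F a ha
  obtain ⟨γ₁, hγ₁, -, -, hC⟩ :=
    Summit.QuantumFields.YangMills.Theorems.K0V23Stub3ComparabilitySuppliers.exists_twoComparable_of_runAbsBound hγ₀ (hrun 0 1 1 1 1)
  exact ⟨a₀, ha₀, hle, γ₁, ε₂₉, 0, 1, 1, 1, 1, (fun _ _ => 0), (fun _ _ => 0), hγ₁, hε, hC⟩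

/-- W-UDR-Ax ⟹ (κ_cof)-Ax — lens-1 g4 `LENS-1-PiDecayRuns-v2.lean` :298 `compCofinalRadiiAx_of_k0PiDecayCofinalRadiiAx` under σ (`theta13OfThm1CCMWZB ↦ theta13OfThm1CCMWZBAx`),
here as a composition through door (ρ_cof)-Ax. [cite: Balaban1987RG1, Thm 3 p.264, (1.22) p.264, (5.10) p.293, (5.42) p.297 (bookkeeping)] -/
theorem k0CompCofinalRadiiAx_of_k0PiDecayCofinalRadiiAx (H : K0PiDecayCofinalRadiiAx) :
    Summit.QuantumFields.YangMills.Theorems.K0V23Stub3DoorSuppliersAx.K0CompCofinalRadiiAx :=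
  k0CompCofinalRadiiAx_of_k0RunCofinalRadiiAx (k0RunCofinalRadiiAx_of_k0PiDecayCofinalRadiiAx H)

/-- **★ W-UDR-Ax ⟹ THE CRUX DECL BY NAME THROUGH THE TREE CLOSER** `K0V23Stub3DoorSuppliersAx.record13SepCoPHInhabitedAx_of_k0CompCofinalRadii` (✓p809897 :218) — the same terminus as
`record13SepCoPHInhabitedAx_of_k0PiDecayCofinalRadiiAx` (§4), routed through the landed (κ_cof)-Ax door: what the TREE lacks for the edge W-UDR → K0ᴬ is this def + lemma only.
A HELPER, NOT a closer; K0ᴬ OPEN; the mass gap is NOT proved. [cite: Balaban1987RG1, Thm 1 p.259, Thm 3 p.264, (1.22) p.264, (5.10) p.293; Balaban1985Variational, Thm 1 (8)–(9) p.279; Balaban1988Convergent, Thm 1 p.262] -/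
theorem record13SepCoPHInhabitedAx_of_k0PiDecayCofinalRadiiAx_tree (H : K0PiDecayCofinalRadiiAx) :
    Summit.QuantumFields.YangMills.Theses.BalabanUVNodes.Record13SepCoPHInhabitedAx :=
  Summit.QuantumFields.YangMills.Theorems.K0V23Stub3DoorSuppliersAx.record13SepCoPHInhabitedAx_of_k0CompCofinalRadii
    (k0CompCofinalRadiiAx_of_k0PiDecayCofinalRadiiAx H)

end Summit.QuantumFields.YangMills.Theorems.K0V23Stub3CofinalRunDoorAx

end
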